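import Summits.AtomisticToContinuum.HydrodynamicLimit.Theorems.LambertianContactSwapLambertianEulerCollisionalFrame
import HarnessLib

/-!
# The per-window bound of the collisional heart of the Lambertian gas (line `Sketch`, crux stmt-11854)

Support file (`--supports stmt-AtomisticToContinuum-11854`).  The window step of lead c8's derivation
`CCW-Λ → CAT-Λ → TL1G-Λ → CollisionalOneBlockInMeanLambdaLog` (`…CollisionalHeartOfInputs`): on a window `[a, a+h] ⊆ [s, s′] ⊆ [0, t]` with
`h₀ ≤ h ≤ 2h₀`, the clamp remainder of the jump functional is read off the instance of CAT-Λ at this `N` (`cat_remainder_le`: the time-clamped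
compensated jump `Jc` agrees with `Jcol` at the counted contacts, `…CollisionalClampSplit.integral_remainder_le_of_lintegral`), and the window
inequality `−E_λ[Σ_{(a,a+h]} J] + E_λ[∫_a^{a+h} Σ X^V] + dLZ(a,a+h) ≤ (h/γ)M + h(ϑ′ + A_C e^{−a_C V²} + A e^{−aV²})(N+1)` follows
(`window_bound`: two-level clamp split of the jumps `neg_jumpSum_le_trunc_add_remainder`, the clamped collisional functional paid by the entropy
step with restart `…CollisionalWindowRestart.neg_clampedFunctional_le_of_ent` fed with the instance of CCW-Λ at this `N`, whose functional `Wcol`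
is the restarted one almost surely).

Lead prover-line-stmt-AtomisticToContinuum-11854-c8-0, 2026-08-17.  [cite: Yau1991, §2] [cite: OllaVaradhanYau1993, §3]
-/

noncomputable section

namespace Summit.AtomisticToContinuum.HydrodynamicLimit.Theorems.LambertianContactSwapLambertianEulerCollisionalWindowBound

open scoped BigOperators Topology ENNReal InnerProductSpace
open MeasureTheory ProbabilityTheory Filter Set InformationTheory
open Literature.MathematicalPhysics.KineticTheory
open Literature.Analysis.FluidPDE Literature.Analysis.FluidPDE.Alexander
open Literature.Analysis.FunctionSpaces
open Summit.AtomisticToContinuum.HydrodynamicLimit.Theorems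
open Summit.AtomisticToContinuum.HydrodynamicLimit.Theorems.LambertianContactSwapLambertianEulerHearts
open Summit.AtomisticToContinuum.HydrodynamicLimit.Theorems.LambertianContactSwapLambertianEulerHeartsLog
open Summit.AtomisticToContinuum.HydrodynamicLimit.Theorems.LambertianContactSwapLambertianEulerCollisionalInputs
open Summit.AtomisticToContinuum.HydrodynamicLimit.Theorems.LambertianContactSwapLambertianEulerKineticWindowTools
open Summit.AtomisticToContinuum.HydrodynamicLimit.Theorems.LambertianContactSwapLambertianEulerProductionSplitTools
open Summit.AtomisticToContinuum.HydrodynamicLimit.Theorems.LambertianContactSwapLambertianEulerRestartInLaw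
open Summit.AtomisticToContinuum.HydrodynamicLimit.Theorems.LambertianContactSwapLambertianEulerJumpSumTools
open Summit.AtomisticToContinuum.HydrodynamicLimit.Theorems.LambertianContactSwapLambertianEulerCollisionalWindowRestart
open Summit.AtomisticToContinuum.HydrodynamicLimit.Theorems.LambertianContactSwapLambertianEulerCollisionalClampSplit
open Summit.AtomisticToContinuum.HydrodynamicLimit.Theorems.LambertianContactSwapLambertianEulerCollisionalJumpWindows
open Summit.AtomisticToContinuum.HydrodynamicLimit.Theorems.LambertianContactSwapLambertianEulerCollisionalFrame
open Summit.AtomisticToContinuum.HydrodynamicLimit.Theorems.LambertianContactSwapLambertianEulerTimeLedgerStopping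

/-- **The clamp remainder of the jump functional on a macroscopic window, from CAT-Λ** (the instance of
`…CollisionalInputs.CollisionActivityTailsLambda` at one `N`, rewritten on the time-clamped compensated jump `Jc`, which agrees with
`Jcol` at the counted contacts of `(a, a+h] ⊆ [0,t]`; `…CollisionalClampSplit.integral_remainder_le_of_lintegral`). [folklore] -/
theorem cat_remainder_le {σ : ℝ} (hσ : 0 < σ) (hσi : σ < 2⁻¹) {a₀ θ₀ : T3 → ℝ} {u₀ : T3 → V3}
    (ha : Continuous a₀) (hθ : Continuous θ₀) (hu : Continuous u₀) (ha0 : ∀ x, 0 < a₀ x) (hθ0 : ∀ x, 0 < θ₀ x)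
    (N : ℕ) (Φ : HardSphereFlow (Torus.geometry (Fin 3)) (hsDiameter σ N) (N + 1))
    {Rf : ℝ → ℝ} {ρ θ : ℝ → T3 → ℝ} {u : ℝ → T3 → V3} {t : ℝ}
    {Jc : ℝ × Config (N + 1) (Fin 3) T3 → ℝ} (hJcm : Measurable Jc) {D : ℝ} (hD0 : 0 ≤ D)
    (hJcD : ∀ q, |Jc q| ≤ D * (1 + configEnergy q.2))
    (hJceq : ∀ t' ∈ Set.Icc 0 t, ∀ w : Config (N + 1) (Fin 3) T3, Jc (t', w) = Jcol σ Rf ρ θ u N t' w)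
    {cJ V R₀ A a h₀ : ℝ} (hℓ : 0 ≤ jumpLevel σ N cJ V) (hA : 0 ≤ A) (hh₀ : 0 < h₀)
    (HA2N : ∀ (a' h : ℝ), 0 ≤ a' → h₀ ≤ h → h ≤ 2 * h₀ → a' + h ≤ t →
      (∫⁻ p, ENNReal.ofReal
          (∑ m ∈ Finset.range (lambertCount (Torus.geometry (Fin 3)) (hsDiameter σ N) p.2 p.1 (a' + h)),
            if a' < (lambertInstant (Torus.geometry (Fin 3)) (hsDiameter σ N) p.2 p.1 (m + 1)).toReal then
              max (|Jcol σ Rf ρ θ u N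
                  (lambertInstant (Torus.geometry (Fin 3)) (hsDiameter σ N) p.2 p.1 (m + 1)).toReal
                  (lambertStateAfter (Torus.geometry (Fin 3)) (hsDiameter σ N) p.2 p.1 m)| -
                jumpLevel σ N cJ V) 0
            else 0)
        ∂((localGibbsLaw σ a₀ u₀ θ₀ N Φ).prod (lambertNoise (Fin 3)))) +
      (∫⁻ p, ENNReal.ofReal (jumpLevel σ N cJ V *
          (((lambertCount (Torus.geometry (Fin 3)) (hsDiameter σ N) p.2 p.1 (a' + h) : ℕ) : ℝ) -
            ((lambertCount (Torus.geometry (Fin 3)) (hsDiameter σ N) p.2 p.1 a' : ℕ) : ℝ) -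
            R₀ * h * ((N : ℝ) + 1) ^ (4 / 3 : ℝ)))
        ∂((localGibbsLaw σ a₀ u₀ θ₀ N Φ).prod (lambertNoise (Fin 3)))) ≤
      ENNReal.ofReal (A * Real.exp (-(a * V ^ 2)) * h * ((N : ℝ) + 1)))
    {a' h : ℝ} (ha' : 0 ≤ a') (hh1 : h₀ ≤ h) (hh2 : h ≤ 2 * h₀) (haht : a' + h ≤ t) :
    ∫ p, ((∑ m ∈ Finset.range (lambertCount (Torus.geometry (Fin 3)) (hsDiameter σ N) p.2 p.1 (a' + h)),
        if a' < (lambertInstant (Torus.geometry (Fin 3)) (hsDiameter σ N) p.2 p.1 (m + 1)).toReal then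
          max (|Jc ((lambertInstant (Torus.geometry (Fin 3)) (hsDiameter σ N) p.2 p.1 (m + 1)).toReal,
            lambertStateAfter (Torus.geometry (Fin 3)) (hsDiameter σ N) p.2 p.1 m)| - jumpLevel σ N cJ V) 0 else 0) +
        max (jumpLevel σ N cJ V * (((lambertCount (Torus.geometry (Fin 3)) (hsDiameter σ N) p.2 p.1 (a' + h) : ℝ) -
          (lambertCount (Torus.geometry (Fin 3)) (hsDiameter σ N) p.2 p.1 a' : ℝ)) - R₀ * h * ((N : ℝ) + 1) ^ (4 / 3 : ℝ))) 0)
      ∂((localGibbsLaw σ a₀ u₀ θ₀ N Φ).prod (lambertNoise (Fin 3))) ≤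
      A * Real.exp (-(a * V ^ 2)) * h * ((N : ℝ) + 1) := by
  have hPL : localGibbsLaw σ a₀ u₀ θ₀ N Φ ≪ liouville (Torus.geometry (Fin 3)) (N + 1) (hsDiameter σ N) := by
    rw [localGibbsLaw, particleLaw_eq]; exact withDensity_absolutelyContinuous _ _
  have hacc : ∀ᵐ p ∂((localGibbsLaw σ a₀ u₀ θ₀ N Φ).prod (lambertNoise (Fin 3))), ∀ T' : ℝ, ∃ k,
      ENNReal.ofReal T' < lambertInstant (Torus.geometry (Fin 3)) (hsDiameter σ N) p.2 p.1 k :=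
    ae_nonAccumulation_of_absolutelyContinuous hσ hσi N _ hPL
  have hh : 0 ≤ h := hh₀.le.trans hh1
  have hB : 0 ≤ A * Real.exp (-(a * V ^ 2)) * h * ((N : ℝ) + 1) := by positivity
  refine integral_remainder_le_of_lintegral hσ hσi ha hθ hu ha0 hθ0 Φ hJcm hD0 hJcD hℓ _ ha'
    (le_add_of_nonneg_right hh) hB ?_
  have hA2w := HA2N a' h ha' hh1 hh2 haht
  -- the first lintegral: clamped = unclamped on the counted contacts of `(a', a'+h] ⊆ [0,t]`
  have hcongr : (fun p : Config (N + 1) (Fin 3) T3 × (ℕ → V3) => ENNReal.ofReal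
      (∑ m ∈ Finset.range (lambertCount (Torus.geometry (Fin 3)) (hsDiameter σ N) p.2 p.1 (a' + h)),
        if a' < (lambertInstant (Torus.geometry (Fin 3)) (hsDiameter σ N) p.2 p.1 (m + 1)).toReal then
          max (|Jc ((lambertInstant (Torus.geometry (Fin 3)) (hsDiameter σ N) p.2 p.1 (m + 1)).toReal,
            lambertStateAfter (Torus.geometry (Fin 3)) (hsDiameter σ N) p.2 p.1 m)| - jumpLevel σ N cJ V) 0 else 0)) =ᵐ[((localGibbsLaw σ a₀ u₀ θ₀ N Φ).prod (lambertNoise (Fin 3)))]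
      fun p => ENNReal.ofReal
      (∑ m ∈ Finset.range (lambertCount (Torus.geometry (Fin 3)) (hsDiameter σ N) p.2 p.1 (a' + h)),
        if a' < (lambertInstant (Torus.geometry (Fin 3)) (hsDiameter σ N) p.2 p.1 (m + 1)).toReal then
          max (|Jcol σ Rf ρ θ u N (lambertInstant (Torus.geometry (Fin 3)) (hsDiameter σ N) p.2 p.1 (m + 1)).toReal
            (lambertStateAfter (Torus.geometry (Fin 3)) (hsDiameter σ N) p.2 p.1 m)| - jumpLevel σ N cJ V) 0 else 0) := by
    filter_upwards [hacc] with p hp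
    congr 1
    refine Finset.sum_congr rfl fun m hm => ?_
    split_ifs with hlt
    · have hle := instant_succ_le_of_lt_lambertCount (hp (a' + h)) (Finset.mem_range.1 hm)
      have hTb : (lambertInstant (Torus.geometry (Fin 3)) (hsDiameter σ N) p.2 p.1 (m + 1)).toReal ≤ a' + h :=
        ENNReal.toReal_le_of_le_ofReal (ha'.trans (le_add_of_nonneg_right hh)) hle
      rw [hJceq _ ⟨ha'.trans hlt.le, hTb.trans haht⟩]
    · rfl
  rw [lintegral_congr_ae hcongr]
  exact hA2w

/-- **THE PER-WINDOW BOUND of the collisional heart.** On a window `[a, a+h] ⊆ [s, s′] ⊆ [0, t]` with `h₀ ≤ h ≤ 2h₀`: clamp split of the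
jump functional by the two-level truncation (`neg_jumpSum_le_trunc_add_remainder`, remainder by CAT-Λ through `cat_remainder_le`), and the
clamped collisional functional `trunc_L(Σ trunc_ℓ J) − ∫Σ X^V − dLZ` paid by the entropy step with restart (`neg_clampedFunctional_le_of_ent`)
fed with the instance of CCW-Λ at this `N` (its functional `Wcol` is the restarted one almost surely):
`−E_λ[Σ_{(a,a+h]} J] + E_λ[∫_a^{a+h} Σ X^V] + dLZ(a,a+h) ≤ (h/γ) M + h (ϑ′ + A_C e^{−a_C V²} + A e^{−aV²}) (N+1)`. [cite: Yau1991, §2] -/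
theorem window_bound : ∀ {σ : ℝ}, 0 < σ → σ < 2⁻¹ → σ ≤ 1 / 2 → ∀ {a₀ θ₀ : T3 → ℝ} {u₀ : T3 → V3},
    Continuous a₀ → Continuous θ₀ → Continuous u₀ → (∀ x, 0 < a₀ x) → (∀ x, 0 < θ₀ x) →
    ∀ (N : ℕ) (Φ : HardSphereFlow (Torus.geometry (Fin 3)) (hsDiameter σ N) (N + 1))
      {Rf : ℝ → ℝ} {ρ θ : ℝ → T3 → ℝ} {u : ℝ → T3 → V3} {t : ℝ},
    (∀ s ∈ Set.Icc 0 t, (Continuous fun x => ρ s x * Rf (σ ^ 3 * ρ s x)) ∧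
      (∀ x, 0 < ρ s x * Rf (σ ^ 3 * ρ s x)) ∧ Continuous (θ s) ∧ Continuous (u s) ∧ ∀ x, 0 < θ s x) →
    (∀ s ∈ Set.Icc 0 t, klDiv (((localGibbsLaw σ a₀ u₀ θ₀ N Φ).prod (lambertNoise (Fin 3))).map
        (fun p => lambertFlow (Torus.geometry (Fin 3)) (hsDiameter σ N) p.2 p.1 s))
      (localGibbsLaw σ (fun x => ρ s x * Rf (σ ^ 3 * ρ s x)) (u s) (θ s) N Φ) ≠ ⊤) →
    ∀ {Jc : ℝ × Config (N + 1) (Fin 3) T3 → ℝ}, Measurable Jc → ∀ {D : ℝ}, 0 ≤ D →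
    (∀ q, |Jc q| ≤ D * (1 + configEnergy q.2)) →
    (∀ (t' : ℝ) (w : Config (N + 1) (Fin 3) T3) (v : ℝ), 0 ≤ v →
      ENNReal.ofReal v < freeExitTime (Torus.geometry (Fin 3)) (hsDiameter σ N) w →
      freeExitTime (Torus.geometry (Fin 3)) (hsDiameter σ N) w ≠ ⊤ →
      Jc (t', freeFlight (Torus.geometry (Fin 3)) v w) = Jc (t', w)) →
    (∀ t' ∈ Set.Icc 0 t, ∀ w : Config (N + 1) (Fin 3) T3, Jc (t', w) = Jcol σ Rf ρ θ u N t' w) →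
    ∀ {GXV : ℝ × (T3 × V3) → ℝ}, Measurable GXV → ∀ {BXV : ℝ}, 0 ≤ BXV → (∀ q, |GXV q| ≤ BXV) →
    ∀ {V : ℝ}, (∀ r' ∈ Set.Icc 0 t, ∀ y : T3 × V3, GXV (r', y) = XcolClamp V σ ρ θ u r' y) →
    ∀ {cJ R₀ A a AC aC γ ϑ' h₀ : ℝ}, 0 < cJ → 0 ≤ R₀ → 0 ≤ A → 0 < γ → 0 < h₀ →
    (∀ (a' h : ℝ), 0 ≤ a' → h₀ ≤ h → h ≤ 2 * h₀ → a' + h ≤ t →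
      (∫⁻ p, ENNReal.ofReal
          (∑ m ∈ Finset.range (lambertCount (Torus.geometry (Fin 3)) (hsDiameter σ N) p.2 p.1 (a' + h)),
            if a' < (lambertInstant (Torus.geometry (Fin 3)) (hsDiameter σ N) p.2 p.1 (m + 1)).toReal then
              max (|Jcol σ Rf ρ θ u N
                  (lambertInstant (Torus.geometry (Fin 3)) (hsDiameter σ N) p.2 p.1 (m + 1)).toReal
                  (lambertStateAfter (Torus.geometry (Fin 3)) (hsDiameter σ N) p.2 p.1 m)| -
                jumpLevel σ N cJ V) 0
            else 0)
        ∂((localGibbsLaw σ a₀ u₀ θ₀ N Φ).prod (lambertNoise (Fin 3)))) +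
      (∫⁻ p, ENNReal.ofReal (jumpLevel σ N cJ V *
          (((lambertCount (Torus.geometry (Fin 3)) (hsDiameter σ N) p.2 p.1 (a' + h) : ℕ) : ℝ) -
            ((lambertCount (Torus.geometry (Fin 3)) (hsDiameter σ N) p.2 p.1 a' : ℕ) : ℝ) -
            R₀ * h * ((N : ℝ) + 1) ^ (4 / 3 : ℝ)))
        ∂((localGibbsLaw σ a₀ u₀ θ₀ N Φ).prod (lambertNoise (Fin 3)))) ≤
      ENNReal.ofReal (A * Real.exp (-(a * V ^ 2)) * h * ((N : ℝ) + 1))) →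
    (∀ (a' h : ℝ), 0 ≤ a' → h₀ ≤ h → h ≤ 2 * h₀ → a' + h ≤ t →
      Real.log (∫ q, Real.exp (-((γ / h) * Wcol σ Rf ρ θ u N V cJ R₀ a' h q))
        ∂((localGibbsLaw σ (fun x => ρ a' x * Rf (σ ^ 3 * ρ a' x)) (u a') (θ a') N Φ).prod
          (lambertNoise (Fin 3)))) ≤ γ * (ϑ' + AC * Real.exp (-(aC * V ^ 2))) * ((N : ℝ) + 1)) →
    ∀ {s s' M : ℝ}, s' ≤ t → (∀ r' ∈ Set.Icc s s', Hent σ a₀ θ₀ u₀ Rf ρ θ u N Φ r' ≤ M) →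
    ∀ {a' h : ℝ}, 0 ≤ a' → h₀ ≤ h → h ≤ 2 * h₀ → a' + h ≤ s' → s ≤ a' →
      -(∫ p, (∑ m ∈ Finset.range (lambertCount (Torus.geometry (Fin 3)) (hsDiameter σ N) p.2 p.1 (a' + h)),
          if a' < (lambertInstant (Torus.geometry (Fin 3)) (hsDiameter σ N) p.2 p.1 (m + 1)).toReal then
            Jc ((lambertInstant (Torus.geometry (Fin 3)) (hsDiameter σ N) p.2 p.1 (m + 1)).toReal,
              lambertStateAfter (Torus.geometry (Fin 3)) (hsDiameter σ N) p.2 p.1 m) else 0)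
          ∂((localGibbsLaw σ a₀ u₀ θ₀ N Φ).prod (lambertNoise (Fin 3)))) +
        (∫ p, (∫ r' in a'..(a' + h), ∑ i, GXV (r', lambertFlow (Torus.geometry (Fin 3)) (hsDiameter σ N) p.2 p.1 r' i))
          ∂((localGibbsLaw σ a₀ u₀ θ₀ N Φ).prod (lambertNoise (Fin 3)))) +
        dLZ σ Rf ρ N a' (a' + h) ≤
      h / γ * M + h * (ϑ' + AC * Real.exp (-(aC * V ^ 2)) + A * Real.exp (-(a * V ^ 2))) * ((N : ℝ) + 1) := by
  intro σ hσ hσi hσ2 a₀ θ₀ u₀ ha hθ hu ha0 hθ0 N Φ Rf ρ θ u t href hfin Jc hJcm D hD0 hJcD hJc_inv hJceq GXV hGXVm BXV hBXV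
    hGXVb V hGXVeq cJ R₀ A a AC aC γ ϑ' h₀ hcJ hR₀0 hA hγ hh₀ HA2N HC1N s s' M hs't hM aw hw haw hhw1 hhw2 hawhs hsaw
  haveI hPlam : IsProbabilityMeasure (localGibbsLaw σ a₀ u₀ θ₀ N Φ) :=
    isProbabilityMeasure_localGibbsLaw ha hθ hu ha0 hθ0 hσ2 N Φ
  have hPL : localGibbsLaw σ a₀ u₀ θ₀ N Φ ≪ liouville (Torus.geometry (Fin 3)) (N + 1) (hsDiameter σ N) := by
    rw [localGibbsLaw, particleLaw_eq]; exact withDensity_absolutelyContinuous _ _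
  have hℓ : 0 ≤ jumpLevel σ N cJ V := by
    unfold jumpLevel; exact mul_nonneg (mul_nonneg hcJ.le (hsDiameter_pos hσ N).le) (sq_nonneg _)
  have hlevel : ∀ h : ℝ, jumpLevel σ N cJ V * (R₀ * h * ((N : ℝ) + 1) ^ (4 / 3 : ℝ)) =
      (cJ * σ * V ^ 2 * R₀ * h) * ((N : ℝ) + 1) := fun h => jumpLevel_mul_window σ N cJ V R₀ h
  have hCAT : ∀ {a' h : ℝ}, 0 ≤ a' → h₀ ≤ h → h ≤ 2 * h₀ → a' + h ≤ t →
      ∫ p, ((∑ m ∈ Finset.range (lambertCount (Torus.geometry (Fin 3)) (hsDiameter σ N) p.2 p.1 (a' + h)),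
          if a' < (lambertInstant (Torus.geometry (Fin 3)) (hsDiameter σ N) p.2 p.1 (m + 1)).toReal then
            max (|Jc ((lambertInstant (Torus.geometry (Fin 3)) (hsDiameter σ N) p.2 p.1 (m + 1)).toReal,
              lambertStateAfter (Torus.geometry (Fin 3)) (hsDiameter σ N) p.2 p.1 m)| - jumpLevel σ N cJ V) 0 else 0) +
          max (jumpLevel σ N cJ V * (((lambertCount (Torus.geometry (Fin 3)) (hsDiameter σ N) p.2 p.1 (a' + h) : ℝ) -
            (lambertCount (Torus.geometry (Fin 3)) (hsDiameter σ N) p.2 p.1 a' : ℝ)) - R₀ * h * ((N : ℝ) + 1) ^ (4 / 3 : ℝ))) 0)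
        ∂((localGibbsLaw σ a₀ u₀ θ₀ N Φ).prod (lambertNoise (Fin 3))) ≤
        A * Real.exp (-(a * V ^ 2)) * h * ((N : ℝ) + 1) := fun ha' hh1 hh2 haht =>
    cat_remainder_le hσ hσi ha hθ hu ha0 hθ0 N Φ hJcm hD0 hJcD hJceq hℓ hA hh₀ HA2N ha' hh1 hh2 haht
  /- ── (D) the clamped collisional functional of a window: entropy step with restart and CCW-Λ ── -/
  have hENT : ∀ (a' h : ℝ), 0 ≤ a' → h₀ ≤ h → h ≤ 2 * h₀ → a' + h ≤ s' → s ≤ a' →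
      -(∫ p, (trunc (jumpLevel σ N cJ V * (R₀ * h * ((N : ℝ) + 1) ^ (4 / 3 : ℝ)))
          (∑ m ∈ Finset.range (lambertCount (Torus.geometry (Fin 3)) (hsDiameter σ N) p.2 p.1 (a' + h)),
            if a' < (lambertInstant (Torus.geometry (Fin 3)) (hsDiameter σ N) p.2 p.1 (m + 1)).toReal then
              trunc (jumpLevel σ N cJ V) (Jc ((lambertInstant (Torus.geometry (Fin 3)) (hsDiameter σ N) p.2 p.1 (m + 1)).toReal,
                lambertStateAfter (Torus.geometry (Fin 3)) (hsDiameter σ N) p.2 p.1 m)) else 0) -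
          (∫ r' in a'..(a' + h), ∑ i, GXV (r', lambertFlow (Torus.geometry (Fin 3)) (hsDiameter σ N) p.2 p.1 r' i)) -
          dLZ σ Rf ρ N a' (a' + h)) ∂((localGibbsLaw σ a₀ u₀ θ₀ N Φ).prod (lambertNoise (Fin 3)))) ≤
        h / γ * (M + γ * (ϑ' + AC * Real.exp (-(aC * V ^ 2))) * ((N : ℝ) + 1)) := by
    intro a' h ha' hh1 hh2 hahs hsa
    have hh : 0 < h := hh₀.trans_le hh1
    have haht : a' + h ≤ t := hahs.trans hs't
    have ha't : a' ∈ Set.Icc 0 t := ⟨ha', by linarith only [hahs, hs't, hh]⟩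
    obtain ⟨hbc, hbpos, hθc, huc, hθpos⟩ := href a' ha't
    haveI : IsProbabilityMeasure (localGibbsLaw σ (fun x => ρ a' x * Rf (σ ^ 3 * ρ a' x)) (u a') (θ a') N Φ) :=
      isProbabilityMeasure_localGibbsLaw hbc hθc huc hbpos hθpos hσ2 N Φ
    have hRL : localGibbsLaw σ (fun x => ρ a' x * Rf (σ ^ 3 * ρ a' x)) (u a') (θ a') N Φ ≪
        liouville (Torus.geometry (Fin 3)) (N + 1) (hsDiameter σ N) := by
      rw [localGibbsLaw, particleLaw_eq]; exact withDensity_absolutelyContinuous _ _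
    have hMa : (klDiv (((localGibbsLaw σ a₀ u₀ θ₀ N Φ).prod (lambertNoise (Fin 3))).map
        (fun p => lambertFlow (Torus.geometry (Fin 3)) (hsDiameter σ N) p.2 p.1 a'))
        (localGibbsLaw σ (fun x => ρ a' x * Rf (σ ^ 3 * ρ a' x)) (u a') (θ a') N Φ)).toReal ≤ M := by
      have h := hM a' ⟨hsa, by linarith only [hahs, hh]⟩
      unfold Hent at h
      exact h
    have hL : 0 ≤ jumpLevel σ N cJ V * (R₀ * h * ((N : ℝ) + 1) ^ (4 / 3 : ℝ)) :=
      mul_nonneg hℓ (by positivity)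
    -- CCW-Λ on this window, rewritten on the restarted functional of the clamped observables
    have hKa := HC1N a' h ha' hh1 hh2 haht
    have haccR : ∀ᵐ q ∂((localGibbsLaw σ (fun x => ρ a' x * Rf (σ ^ 3 * ρ a' x)) (u a') (θ a') N Φ).prod
        (lambertNoise (Fin 3))), ∀ T' : ℝ, ∃ k,
        ENNReal.ofReal T' < lambertInstant (Torus.geometry (Fin 3)) (hsDiameter σ N) q.2 q.1 k :=
      ae_nonAccumulation_of_absolutelyContinuous hσ hσi N _ hRL
    have hWeq : (fun q : Config (N + 1) (Fin 3) T3 × (ℕ → V3) => Real.exp (-(γ / h * Wcol σ Rf ρ θ u N V cJ R₀ a' h q))) =ᵐ[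
        (localGibbsLaw σ (fun x => ρ a' x * Rf (σ ^ 3 * ρ a' x)) (u a') (θ a') N Φ).prod (lambertNoise (Fin 3))]
        fun q => Real.exp (-(γ / h *
          (trunc (jumpLevel σ N cJ V * (R₀ * h * ((N : ℝ) + 1) ^ (4 / 3 : ℝ)))
            (∑ m ∈ Finset.range (lambertCount (Torus.geometry (Fin 3)) (hsDiameter σ N) q.2 q.1 h),
              if 0 < (lambertInstant (Torus.geometry (Fin 3)) (hsDiameter σ N) q.2 q.1 (m + 1)).toReal then
                trunc (jumpLevel σ N cJ V) (Jc (a' + (lambertInstant (Torus.geometry (Fin 3)) (hsDiameter σ N) q.2 q.1 (m + 1)).toReal,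
                  lambertStateAfter (Torus.geometry (Fin 3)) (hsDiameter σ N) q.2 q.1 m)) else 0) -
            (∫ r' in (0 : ℝ)..h, ∑ i, GXV (a' + r', lambertFlow (Torus.geometry (Fin 3)) (hsDiameter σ N) q.2 q.1 r' i)) -
            dLZ σ Rf ρ N a' (a' + h)))) := by
      filter_upwards [haccR] with q hq
      have k1 : (∑ m ∈ Finset.range (lambertCount (Torus.geometry (Fin 3)) (hsDiameter σ N) q.2 q.1 h),
          if 0 < (lambertInstant (Torus.geometry (Fin 3)) (hsDiameter σ N) q.2 q.1 (m + 1)).toReal then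
            trunc (jumpLevel σ N cJ V)
              (Jcol σ Rf ρ θ u N (a' + (lambertInstant (Torus.geometry (Fin 3)) (hsDiameter σ N) q.2 q.1 (m + 1)).toReal)
                (lambertStateAfter (Torus.geometry (Fin 3)) (hsDiameter σ N) q.2 q.1 m))
          else 0) =
          ∑ m ∈ Finset.range (lambertCount (Torus.geometry (Fin 3)) (hsDiameter σ N) q.2 q.1 h),
            if 0 < (lambertInstant (Torus.geometry (Fin 3)) (hsDiameter σ N) q.2 q.1 (m + 1)).toReal then
              trunc (jumpLevel σ N cJ V) (Jc (a' + (lambertInstant (Torus.geometry (Fin 3)) (hsDiameter σ N) q.2 q.1 (m + 1)).toReal,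
                lambertStateAfter (Torus.geometry (Fin 3)) (hsDiameter σ N) q.2 q.1 m)) else 0 := by
        refine Finset.sum_congr rfl fun m hm => ?_
        split_ifs with hlt
        · have hle := instant_succ_le_of_lt_lambertCount (hq h) (Finset.mem_range.1 hm)
          have hTb : (lambertInstant (Torus.geometry (Fin 3)) (hsDiameter σ N) q.2 q.1 (m + 1)).toReal ≤ h :=
            ENNReal.toReal_le_of_le_ofReal hh.le hle
          rw [hJceq _ ⟨by linarith only [ha', hlt], by linarith only [hTb, haht]⟩]
        · rfl
      have k2 : (∫ r' in (0 : ℝ)..h, ∑ i : Fin (N + 1),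
          XcolClamp V σ ρ θ u (a' + r') (lambertFlow (Torus.geometry (Fin 3)) (hsDiameter σ N) q.2 q.1 r' i)) =
          ∫ r' in (0 : ℝ)..h, ∑ i, GXV (a' + r', lambertFlow (Torus.geometry (Fin 3)) (hsDiameter σ N) q.2 q.1 r' i) := by
        refine intervalIntegral.integral_congr fun r' hr' => ?_
        rw [Set.uIcc_of_le hh.le] at hr'
        exact Finset.sum_congr rfl fun i _ => (hGXVeq (a' + r') ⟨by linarith only [ha', hr'.1], by linarith only [hr'.2, haht]⟩ _).symm
      simp only [Wcol, sumLevel, k1, k2]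
    have hΓ : Real.log (∫ q, Real.exp (-(γ / h *
          (trunc (jumpLevel σ N cJ V * (R₀ * h * ((N : ℝ) + 1) ^ (4 / 3 : ℝ)))
            (∑ m ∈ Finset.range (lambertCount (Torus.geometry (Fin 3)) (hsDiameter σ N) q.2 q.1 h),
              if 0 < (lambertInstant (Torus.geometry (Fin 3)) (hsDiameter σ N) q.2 q.1 (m + 1)).toReal then
                trunc (jumpLevel σ N cJ V) (Jc (a' + (lambertInstant (Torus.geometry (Fin 3)) (hsDiameter σ N) q.2 q.1 (m + 1)).toReal,
                  lambertStateAfter (Torus.geometry (Fin 3)) (hsDiameter σ N) q.2 q.1 m)) else 0) -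
            (∫ r' in (0 : ℝ)..h, ∑ i, GXV (a' + r', lambertFlow (Torus.geometry (Fin 3)) (hsDiameter σ N) q.2 q.1 r' i)) -
            dLZ σ Rf ρ N a' (a' + h))))
        ∂((localGibbsLaw σ (fun x => ρ a' x * Rf (σ ^ 3 * ρ a' x)) (u a') (θ a') N Φ).prod (lambertNoise (Fin 3)))) ≤
        γ * (ϑ' + AC * Real.exp (-(aC * V ^ 2))) * ((N : ℝ) + 1) := by
      rw [← integral_congr_ae hWeq]
      exact hKa
    exact neg_clampedFunctional_le_of_ent hσ hσi N (localGibbsLaw σ a₀ u₀ θ₀ N Φ)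
      (localGibbsLaw σ (fun x => ρ a' x * Rf (σ ^ 3 * ρ a' x)) (u a') (θ a') N Φ) hPL hJcm hJc_inv hGXVm hGXVb
      (jumpLevel σ N cJ V) hL (dLZ σ Rf ρ N a' (a' + h)) ha' hh hγ (hfin a' ha't) hMa hΓ
  /- ── (E) the per-window bound: clamp split of the jumps + entropy step + CAT-Λ ── -/
  have hwindow : ∀ (a' h : ℝ), 0 ≤ a' → h₀ ≤ h → h ≤ 2 * h₀ → a' + h ≤ s' → s ≤ a' →
      -(∫ p, (∑ m ∈ Finset.range (lambertCount (Torus.geometry (Fin 3)) (hsDiameter σ N) p.2 p.1 (a' + h)),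
          if a' < (lambertInstant (Torus.geometry (Fin 3)) (hsDiameter σ N) p.2 p.1 (m + 1)).toReal then
            Jc ((lambertInstant (Torus.geometry (Fin 3)) (hsDiameter σ N) p.2 p.1 (m + 1)).toReal,
              lambertStateAfter (Torus.geometry (Fin 3)) (hsDiameter σ N) p.2 p.1 m) else 0) ∂((localGibbsLaw σ a₀ u₀ θ₀ N Φ).prod (lambertNoise (Fin 3)))) +
        (∫ p, (∫ r' in a'..(a' + h), ∑ i, GXV (r', lambertFlow (Torus.geometry (Fin 3)) (hsDiameter σ N) p.2 p.1 r' i)) ∂((localGibbsLaw σ a₀ u₀ θ₀ N Φ).prod (lambertNoise (Fin 3)))) +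
        dLZ σ Rf ρ N a' (a' + h) ≤
      h / γ * M + h * (ϑ' + AC * Real.exp (-(aC * V ^ 2)) + A * Real.exp (-(a * V ^ 2))) * ((N : ℝ) + 1) := by
    intro a' h ha' hh1 hh2 hahs hsa
    have hh : 0 < h := hh₀.trans_le hh1
    have haht : a' + h ≤ t := hahs.trans hs't
    have hM' : 0 ≤ R₀ * h * ((N : ℝ) + 1) ^ (4 / 3 : ℝ) := by positivity
    -- clamp split of the jump functional on the window
    have hJsplit := neg_jumpSum_le_trunc_add_remainder hσ hσi ha hθ hu ha0 hθ0 Φ hJcm hD0 hJcD hℓ hM' ha'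
      (le_add_of_nonneg_right hh.le)
    have hcat := hCAT ha' hh1 hh2 haht
    have hent := hENT a' h ha' hh1 hh2 hahs hsa
    -- integrability of the two pieces of the clamped functional (to split the expectation)
    have hITL := integrable_truncSum hσ hσi N ((localGibbsLaw σ a₀ u₀ θ₀ N Φ).prod (lambertNoise (Fin 3))) hJcm (jumpLevel σ N cJ V) (L := jumpLevel σ N cJ V *
      (R₀ * h * ((N : ℝ) + 1) ^ (4 / 3 : ℝ))) (mul_nonneg hℓ hM') a' (a' + h)
    have hcub : ∀ r' ∈ Set.Icc a' (a' + h), ∀ y : T3 × V3, |GXV (r', y)| ≤ BXV * (1 + ‖y.2‖) ^ 3 := by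
      intro r' _ y
      have h1 : (1 : ℝ) ≤ (1 + ‖y.2‖) ^ 3 := one_le_pow₀ (by linarith only [norm_nonneg y.2])
      exact (hGXVb _).trans (le_mul_of_one_le_right hBXV h1)
    have hIXV := (integrable_window_functional hσ hσi ha hθ hu ha0 hθ0 Φ hGXVm (le_add_of_nonneg_right hh.le) hBXV
      hcub).2.1
    have hlin : (∫ p, (trunc (jumpLevel σ N cJ V * (R₀ * h * ((N : ℝ) + 1) ^ (4 / 3 : ℝ)))
          (∑ m ∈ Finset.range (lambertCount (Torus.geometry (Fin 3)) (hsDiameter σ N) p.2 p.1 (a' + h)),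
            if a' < (lambertInstant (Torus.geometry (Fin 3)) (hsDiameter σ N) p.2 p.1 (m + 1)).toReal then
              trunc (jumpLevel σ N cJ V) (Jc ((lambertInstant (Torus.geometry (Fin 3)) (hsDiameter σ N) p.2 p.1 (m + 1)).toReal,
                lambertStateAfter (Torus.geometry (Fin 3)) (hsDiameter σ N) p.2 p.1 m)) else 0) -
          (∫ r' in a'..(a' + h), ∑ i, GXV (r', lambertFlow (Torus.geometry (Fin 3)) (hsDiameter σ N) p.2 p.1 r' i)) -
          dLZ σ Rf ρ N a' (a' + h)) ∂((localGibbsLaw σ a₀ u₀ θ₀ N Φ).prod (lambertNoise (Fin 3)))) =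
        (∫ p, trunc (jumpLevel σ N cJ V * (R₀ * h * ((N : ℝ) + 1) ^ (4 / 3 : ℝ)))
          (∑ m ∈ Finset.range (lambertCount (Torus.geometry (Fin 3)) (hsDiameter σ N) p.2 p.1 (a' + h)),
            if a' < (lambertInstant (Torus.geometry (Fin 3)) (hsDiameter σ N) p.2 p.1 (m + 1)).toReal then
              trunc (jumpLevel σ N cJ V) (Jc ((lambertInstant (Torus.geometry (Fin 3)) (hsDiameter σ N) p.2 p.1 (m + 1)).toReal,
                lambertStateAfter (Torus.geometry (Fin 3)) (hsDiameter σ N) p.2 p.1 m)) else 0) ∂((localGibbsLaw σ a₀ u₀ θ₀ N Φ).prod (lambertNoise (Fin 3)))) -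
        (∫ p, (∫ r' in a'..(a' + h), ∑ i, GXV (r', lambertFlow (Torus.geometry (Fin 3)) (hsDiameter σ N) p.2 p.1 r' i)) ∂((localGibbsLaw σ a₀ u₀ θ₀ N Φ).prod (lambertNoise (Fin 3)))) -
        dLZ σ Rf ρ N a' (a' + h) := by
      have e1 := integral_sub (hITL.sub hIXV) (integrable_const (dLZ σ Rf ρ N a' (a' + h)))
      have e2 := integral_sub hITL hIXV
      simp only [Pi.sub_apply] at e1
      rw [e1, e2, integral_const, probReal_univ, one_smul]
    rw [hlin] at hent
    have hsum : h / γ * (M + γ * (ϑ' + AC * Real.exp (-(aC * V ^ 2))) * ((N : ℝ) + 1)) +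
        A * Real.exp (-(a * V ^ 2)) * h * ((N : ℝ) + 1) =
        h / γ * M + h * (ϑ' + AC * Real.exp (-(aC * V ^ 2)) + A * Real.exp (-(a * V ^ 2))) * ((N : ℝ) + 1) := by
      field_simp
      ring
    linarith only [hJsplit, hcat, hent, hsum]
  /- ── (F) the two cases ── -/
  exact hwindow aw hw haw hhw1 hhw2 hawhs hsaw

end Summit.AtomisticToContinuum.HydrodynamicLimit.Theorems.LambertianContactSwapLambertianEulerCollisionalWindowBound
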